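import Summits.BirchSwinnertonDyer.BirchSwinnertonDyer.Theorems.ThetaPartnerAtTwoSignedControlAtTwoRelaxedTwistCount
import Summits.BirchSwinnertonDyer.BirchSwinnertonDyer.Theorems.ThetaPartnerAtTwoSignedControlAtTwoTwistRestrictInjective
import Summits.BirchSwinnertonDyer.BirchSwinnertonDyer.Theorems.ByReductionTypeAtTwoMultTransportTwistedLiftUnramified
import Literature.NumberTheory.EllipticCurves.ZpExtensionGaloisTwistExponentProofs
import Literature.NumberTheory.EllipticCurves.IwasawaTwistedInvariantsFiniteProofs
import Literature.NumberTheory.EllipticCurves.IwasawaAlgebraGenericTwistFiniteProofs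
import Literature.NumberTheory.EllipticCurves.IwasawaSelmerDualProofs
import Literature.NumberTheory.EllipticCurves.GreenbergVatsal2000.NonPrimitiveDatumSelmerInvariants
import HarnessLib

/-!
# TWIST ROAD T3 — the Pontryagin dual of `H¹(K_Σ/K_∞, E[p^∞])` is not `Λ`-torsion, from Poitou–Tate

Support file for crux `SignedControlAtTwo` (stmt-BirchSwinnertonDyer-20309, line `eulerchar`, stub
`stub_pubGreenbergI1Two`): it supplies the ROLE of the (I1) antecedent
`WeierstrassCurve.relaxedSelmer_torsion_card_growth` in K4 — «the dual `Y` of `H = H¹(K_Σ/K_∞, E[p^∞])` is not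
`Λ`-torsion» — directly from the tree's canonical Poitou–Tate fact
`Literature.NumberTheory.GaloisCohomology.poitouTate_selmerStructure_duality K`, WITHOUT the layers `K_n`
(Greenberg's level-`K` twist argument, LNM 1716 pp. 115–117, 123–124).

* §1 `finite_setOf_zsmul_apply_eq_of_finite_quotient`: the `p`-adic half of the Pontryagin dictionary —
  `Y/(T − c)Y` finite ⟹ `{s ∈ H : u • conj_γ s = s}` finite when `u (1 + c) ≡ 1 (mod p^k)` for all `k`
  (companion of the tree's integer half `IwasawaDual.finite_setOf_apply_eq_zsmul_of_finite_quotient`).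
* §2 `exists_int_unit_avoiding`: an integer `u ≡ 1 (mod p)`, a unit of `ℤ_p`, with `u − 1` and `u⁻¹ − 1` both outside
  a given finite subset of `ℤ_p` (the units `1 + p(j+1)`, `j ∈ ℕ`, are pairwise distinct with pairwise distinct inverses).
* §3 `not_isTorsion_dual_h1Sigma_of_poitouTate`: the assembly. If `Y` were torsion, all but finitely many
  `c ∈ 𝔪` give `Y/(T − c)Y` finite (`IwasawaAlgebra.finite_setOf_not_finite_quotient_X_sub_C`); pick `u` by §2; the
  eigenspaces `A = {conj_γ s = u s}`, `B = {u conj_γ s = s}` of `H` are finite; at level `k = #A·#B + 1`, with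
  `u u' ≡ 1 (mod p^k)`, the relaxed twisted Selmer groups `H¹_rel(K, E[p^k](χ_u))`, `H¹_rel(K, E[p^k](χ_{u'}))`
  inject into `B`, `A` (T2 `TwistRestrict.twistedTorsionToH1_injective`, which needs `E(K)[p] = 0`; membership by
  `MultTransportTwistedDescent.twistedTorsionToH1_mem_unramifiedOutside`, eigen-relations by
  `zsmul_conjH1_twistedTorsionToH1` / `conjH1_twistedTorsionToH1_eq_zsmul`), while T1
  (`RelaxedTwistCount.prime_pow_le_natCard_selmerGroup_twisted_mul`, from Poitou–Tate) makes the product of their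
  orders `≥ p^{2k} > #A·#B` — contradiction.

HONEST FRAMING. Everything here is CONDITIONAL on the named Poitou–Tate fact `hPT` (a published theorem the tree
holds as a `Prop`, MilneADT2006 I.4.10) and on `E(K)[p] = 0` (`hK`); the output has exactly the hypothesis list of the
lead's `H1SigmaGrowth.not_isTorsion_dual_h1Sigma_of_relaxedCount` with (I1) replaced by `hPT`, `hK`, good reduction off
`S₀ ∪ {v ∣ p}` and one place `v ∋ p`. It does not prove (I1) itself (no layers), nor Prop. 4.12, nor Cassels'
surjectivity, nor the crux; BSD is not proved by any of this.
-/

set_option linter.dupNamespace false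

noncomputable section
open scoped Classical
open CategoryTheory Field NumberField IsDedekindDomain Function
open Literature.NumberTheory.EllipticCurves Literature.NumberTheory.EllipticCurves.GreenbergVatsal2000
open Literature.NumberTheory.GaloisRepresentations
open Literature.NumberTheory.GaloisRepresentations.DiscreteGaloisModule (SelmerStructure unramifiedSubgroup)
open Literature.NumberTheory.GaloisCohomology
open scoped ContRepresentation
namespace Summit.BirchSwinnertonDyer.BirchSwinnertonDyer.Theorems.SignedEC.TwistNotTorsion

/-! ## §1 The p-adic dictionary: `X/(T − c)X` finite ⟹ `{s : u · φ s = s}` finite, `u (1 + c) = 1` -/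

section Generic

variable {S : Type*} [AddCommGroup S] {p : ℕ} [Fact p.Prime] (φ : AddMonoid.End S)
  {X : Type} [AddCommGroup X] [Module (IwasawaAlgebra p) X]
  (d : X →+ (S →+ AddCircle (1 : ℚ)))

omit [Fact p.Prime] in
/-- An integer `≡ 1 (mod p^k)` acts trivially on `p^k`-torsion. [folklore] -/
theorem zsmul_eq_self_of_dvd {A : Type*} [AddCommGroup A] {k : ℕ} {n : ℤ} (hn : ((p : ℤ) ^ k) ∣ n - 1)
    {t : A} (ht : p ^ k • t = 0) : n • t = t := by
  obtain ⟨q, hq⟩ := hn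
  have hn' : n = 1 + (p : ℤ) ^ k * q := by rw [← hq]; ring
  rw [hn', add_zsmul, one_zsmul, mul_comm, mul_zsmul, ← Nat.cast_pow, natCast_zsmul, ht, zsmul_zero, add_zero]

/-- **`X/(T − c)X` finite ⟹ `{s : u • φ s = s}` finite**, for `u (1 + c) ≡ 1 (mod p^k)` at every level `k` (the
INVERSE twist: `1 + c = u⁻¹` in `ℤ_p`), when `toDual : X → Hom(S, ℚ/ℤ)` is a bijection: for such `s` (killed by `p^k`)
the character `x ↦ toDual x s` kills `(T − c)X` (`toDual(Tx) s = toDual x (φ s − s)`, `toDual(c·x) s = c̄ • toDual x s`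
and `toDual x (φ s) = (1 + c̄) • toDual x s` because `u • toDual x (φ s) = toDual x s`), hence is a character of the
finite group `X/(T − c)X`; distinct `s` give distinct characters. p-adic companion of the tree's
`IwasawaDual.finite_setOf_apply_eq_zsmul_of_finite_quotient` (integer eigenvalues). [cite: GreenbergLNM1716, §4 pp. 104, 124] -/
theorem finite_setOf_zsmul_apply_eq_of_finite_quotient (htor : ∀ s : S, ∃ k : ℕ, p ^ k • s = 0)
    (hT : ∀ (x : X) (s : S), d ((PowerSeries.X : IwasawaAlgebra p) • x) s = d x (φ s) - d x s)
    (hC : ∀ (c : ℤ_[p]) (x : X) (s : S) (k : ℕ), (p ^ k) • s = 0 →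
      d (PowerSeries.C c • x) s = (PadicInt.toZModPow k c).val • d x s)
    (hbij : Function.Bijective d) (c : ℤ_[p]) (u : ℤ)
    (huc : ∀ k : ℕ, ((p : ℤ) ^ k) ∣ u * (1 + ((PadicInt.toZModPow k c).val : ℤ)) - 1)
    (hfin : Finite (X ⧸ (Ideal.span {(PowerSeries.X - PowerSeries.C c : IwasawaAlgebra p)} •
      (⊤ : Submodule (IwasawaAlgebra p) X)))) :
    {s : S | u • φ s = s}.Finite := by
  set θ : IwasawaAlgebra p := PowerSeries.X - PowerSeries.C c with hθ
  set N : Submodule (IwasawaAlgebra p) X := Ideal.span {θ} • (⊤ : Submodule (IwasawaAlgebra p) X) with hN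
  -- for `s` with `u • φ s = s`, the character `x ↦ toDual x s` vanishes on `N = θ X`
  have hvan : ∀ s : S, u • φ s = s → ∀ n ∈ N, d n s = 0 := by
    intro s hs n hn
    obtain ⟨k, hk⟩ := htor s
    have hkφ : p ^ k • φ s = 0 := by rw [← map_nsmul, hk, map_zero]
    -- `toDual x (φ s) = (1 + c̄) • toDual x s`
    have hkey : ∀ x : X, d x (φ s) = (1 + ((PadicInt.toZModPow k c).val : ℤ)) • d x s := by
      intro x
      have h1 : u • d x (φ s) = d x s := by rw [← map_zsmul, hs]
      have ht' : p ^ k • d x (φ s) = 0 := by rw [← map_nsmul, hkφ, map_zero]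
      calc d x (φ s) = (u * (1 + ((PadicInt.toZModPow k c).val : ℤ))) • d x (φ s) :=
            (zsmul_eq_self_of_dvd (huc k) ht').symm
        _ = (1 + ((PadicInt.toZModPow k c).val : ℤ)) • (u • d x (φ s)) := by rw [mul_comm, mul_zsmul]
        _ = (1 + ((PadicInt.toZModPow k c).val : ℤ)) • d x s := by rw [h1]
    refine Submodule.smul_induction_on hn (fun r hr y _ ↦ ?_) (fun a b ha hb ↦ ?_)
    · obtain ⟨a, rfl⟩ := Ideal.mem_span_singleton'.mp hr
      rw [mul_comm, mul_smul, hθ, sub_smul, map_sub, AddMonoidHom.sub_apply, hT, hC c _ s k hk, hkey,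
        add_zsmul, one_zsmul, natCast_zsmul]
      abel
    · rw [map_add, AddMonoidHom.add_apply, ha, hb, add_zero]
  haveI : Finite (X ⧸ N.toAddSubgroup) := hfin
  haveI : Finite (X ⧸ N.toAddSubgroup →+ AddCircle (1 : ℚ)) :=
    PontryaginCard.finite_characterModule_of_finite (X ⧸ N.toAddSubgroup)
  let χ : {s : S | u • φ s = s} → (X ⧸ N.toAddSubgroup →+ AddCircle (1 : ℚ)) := fun s ↦
    QuotientAddGroup.lift N.toAddSubgroup (d.flip (s : S)) fun n hn ↦ by
      rw [AddMonoidHom.mem_ker, AddMonoidHom.flip_apply]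
      exact hvan s s.2 n hn
  refine Set.finite_coe_iff.mp (Finite.of_injective χ fun s s' hss' ↦ ?_)
  apply Subtype.ext
  by_contra hne
  obtain ⟨cc, hc⟩ := CharacterModule.exists_character_apply_ne_zero_of_ne_zero (sub_ne_zero.mpr hne)
  obtain ⟨x, rfl⟩ := hbij.2 cc
  have h := congrArg (fun f : X ⧸ N.toAddSubgroup →+ AddCircle (1 : ℚ) ↦ f (QuotientAddGroup.mk x)) hss'
  simp only [χ, QuotientAddGroup.lift_mk, AddMonoidHom.flip_apply] at h
  have h2 : d x ((s : S) - (s' : S)) = 0 := by rw [map_sub, sub_eq_zero]; exact h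
  exact hc h2

end Generic


/-! ## §2 The dual of `H¹(K_Σ/K_∞, E[p^∞])` is not `Λ`-torsion -/

section Assembly

variable {K : Type} [Field K] [NumberField K] (W : WeierstrassCurve K) [W.IsElliptic] (p : ℕ) [Fact p.Prime]
  (κ : ZpExtension K p) {γ : absoluteGaloisGroup K}

/-- **A unit `u ≡ 1 (mod p)` of `ℤ` avoiding a finite set of `p`-adic parameters together with its inverse**: for a
finite `Bad ⊆ ℤ_p` there is an integer `u` with `p ∣ u − 1`, `u` a unit of `ℤ_p`, `u − 1 ∉ Bad` and
`u⁻¹ − 1 ∉ Bad` (`u = 1 + p(j+1)`; both `j ↦ u − 1` and `j ↦ u⁻¹ − 1` are injective). [folklore] -/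
theorem exists_int_unit_avoiding {Bad : Set ℤ_[p]} (hBad : Bad.Finite) :
    ∃ u : ℤ, (p : ℤ) ∣ u - 1 ∧ IsUnit (u : ℤ_[p]) ∧ ((u : ℤ_[p]) - 1) ∉ Bad ∧
      (Ring.inverse (u : ℤ_[p]) - 1) ∉ Bad := by
  have hprime : p.Prime := Fact.out
  let U : ℕ → ℤ := fun j ↦ 1 + p * (j + 1)
  have hUdvd : ∀ j, (p : ℤ) ∣ U j - 1 := fun j ↦ ⟨j + 1, by simp [U]⟩
  have hUunit : ∀ j, IsUnit ((U j : ℤ) : ℤ_[p]) := by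
    intro j
    by_contra h
    have hlt : ‖((U j : ℤ) : ℤ_[p])‖ < 1 := PadicInt.mem_nonunits.mp (mem_nonunits_iff.mpr h)
    have hdvd : (p : ℤ) ∣ U j := (PadicInt.norm_int_lt_one_iff_dvd _).mp hlt
    have h1 : (p : ℤ) ∣ 1 := by
      have := dvd_sub hdvd (hUdvd j)
      rwa [sub_sub_cancel] at this
    exact hprime.not_dvd_one (by exact_mod_cast h1)
  let f₁ : ℕ → ℤ_[p] := fun j ↦ ((U j : ℤ) : ℤ_[p]) - 1
  let f₂ : ℕ → ℤ_[p] := fun j ↦ Ring.inverse ((U j : ℤ) : ℤ_[p]) - 1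
  have hU_inj : Function.Injective (fun j : ℕ ↦ ((U j : ℤ) : ℤ_[p])) := by
    intro j j' h
    have h0 : ((U j : ℤ) : ℤ_[p]) = ((U j' : ℤ) : ℤ_[p]) := h
    have h' : (U j : ℤ) = U j' := by exact_mod_cast h0
    simp only [U] at h'
    have hp0 : (p : ℤ) ≠ 0 := by exact_mod_cast hprime.ne_zero
    have := mul_left_cancel₀ hp0 (add_left_cancel h')
    exact_mod_cast (add_right_cancel this : (j : ℤ) = j')
  have hf₁ : Function.Injective f₁ := fun j j' h ↦ hU_inj (sub_left_injective h)
  have hf₂ : Function.Injective f₂ := by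
    intro j j' h
    have h' : Ring.inverse ((U j : ℤ) : ℤ_[p]) = Ring.inverse ((U j' : ℤ) : ℤ_[p]) := sub_left_injective h
    apply hU_inj
    change ((U j : ℤ) : ℤ_[p]) = ((U j' : ℤ) : ℤ_[p])
    calc ((U j : ℤ) : ℤ_[p]) = ((U j : ℤ) : ℤ_[p]) * (Ring.inverse ((U j' : ℤ) : ℤ_[p]) * ((U j' : ℤ) : ℤ_[p])) := by
          rw [Ring.inverse_mul_cancel _ (hUunit j'), mul_one]
      _ = ((U j : ℤ) : ℤ_[p]) * Ring.inverse ((U j : ℤ) : ℤ_[p]) * ((U j' : ℤ) : ℤ_[p]) := by rw [← h', mul_assoc]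
      _ = ((U j' : ℤ) : ℤ_[p]) := by rw [Ring.mul_inverse_cancel _ (hUunit j), one_mul]
  have hfin : (f₁ ⁻¹' Bad ∪ f₂ ⁻¹' Bad).Finite :=
    (hBad.preimage hf₁.injOn).union (hBad.preimage hf₂.injOn)
  obtain ⟨j, -, hj⟩ := Set.Infinite.exists_notMem_finset (Set.infinite_univ (α := ℕ)) hfin.toFinset
  rw [Set.Finite.mem_toFinset, Set.mem_union, not_or, Set.mem_preimage, Set.mem_preimage] at hj
  exact ⟨U j, hUdvd j, hUunit j, hj.1, hj.2⟩

/-- **TWIST ROAD, conclusion: the Pontryagin dual of `H = H¹(K_Σ/K_∞, E[p^∞])` is NOT `Λ`-torsion**, for EVERY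
finitely generated dual datum `(Y, dY, hT, hC)` of `H = unramifiedOutside (ker κ) E[p^∞] p S₀`, GIVEN Poitou–Tate for
Selmer structures (`poitouTate_selmerStructure_duality K`), good reduction off `S₀ ∪ {v ∣ p}`, a place `v ∋ p`, a
topological generator `γ` of the `ℤ_p`-extension `κ`, and `E(K)[p] = 0`. Greenberg's level-`K` road (LNM 1716
pp. 115–117, 123–124): if `Y` were torsion, `Y/(T − c)Y` would be finite for all `c ∈ 𝔪_{ℤ_p}` outside a finite set
(`IwasawaAlgebra.finite_setOf_not_finite_quotient_X_sub_C`); choose an integer `u ≡ 1 (mod p)` with `u − 1` and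
`u⁻¹ − 1` both outside it, so that the eigenspaces `A = {s ∈ H : conj_γ s = u·s}` and `B = {s ∈ H : u·conj_γ s = s}` are
FINITE (Pontryagin dictionary, integer and p-adic forms); but for every `k`, with `u u'_k ≡ 1 (mod p^k)`, the relaxed
twisted classes `H¹_rel(K, E[p^k](χ_{u'_k}))`, `H¹_rel(K, E[p^k](χ_u))` inject (`twistedTorsionToH1_injective`) into `A`,
`B` respectively (`conjH1_twistedTorsionToH1_eq_zsmul`, `zsmul_conjH1_twistedTorsionToH1`,
`twistedTorsionToH1_mem_unramifiedOutside`) and their orders multiply to `≥ p^{2k}` (T1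
`prime_pow_le_natCard_selmerGroup_twisted_mul`) — absurd for `k` large. The output shape is the hypothesis list of
the lead's `H1SigmaGrowth.not_isTorsion_dual_h1Sigma_of_relaxedCount` with (I1) REPLACED by the Poitou–Tate fact and
`E(K)[p] = 0`. [cite: GreenbergLNM1716, §4 pp. 107, 115–117, 122–124] [cite: MilneADT2006, Ch. I, Thm. 4.10] -/
theorem not_isTorsion_dual_h1Sigma_of_poitouTate (hPT : poitouTate_selmerStructure_duality K)
    (hγ : κ.IsTopGenerator γ) {S₀ : Set (HeightOneSpectrum (𝓞 K))}
    (hgood : ∀ u : HeightOneSpectrum (𝓞 K), u ∉ S₀ → ((p : ℕ) : 𝓞 K) ∉ u.asIdeal → W.HasGoodReductionAt u)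
    {v : HeightOneSpectrum (𝓞 K)} (hpv : ((p : ℕ) : 𝓞 K) ∈ v.asIdeal)
    (hK : ∀ P : W.toAffine.Point, p • P = 0 → P = 0)
    {Y : Type} [AddCommGroup Y] [Module (IwasawaAlgebra p) Y] [Module.Finite (IwasawaAlgebra p) Y]
    (dY : Y →+ (unramifiedOutside κ.kerSubgroup (W.geomPrimaryTorsion p) p S₀ →+ AddCircle (1 : ℚ)))
    (hbij : Function.Bijective dY)
    (hT : ∀ (y : Y) (x : unramifiedOutside κ.kerSubgroup (W.geomPrimaryTorsion p) p S₀),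
      dY ((PowerSeries.X : IwasawaAlgebra p) • y) x =
        dY y ⟨W.conjH1 p κ.kerSubgroup γ x,
          conjH1_mem_unramifiedOutside κ.kerSubgroup (W.geomPrimaryTorsion p) p _ γ x.2⟩ - dY y x)
    (hC : ∀ (a : ℤ_[p]) (y : Y) (x : unramifiedOutside κ.kerSubgroup (W.geomPrimaryTorsion p) p S₀) (k : ℕ),
      (p ^ k) • x = 0 → dY (PowerSeries.C a • y) x = (PadicInt.toZModPow k a).val • dY y x) :
    ¬ Module.IsTorsion (IwasawaAlgebra p) Y := by
  classical
  intro hY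
  have hprime : p.Prime := Fact.out
  let H := unramifiedOutside κ.kerSubgroup (W.geomPrimaryTorsion p) p S₀
  -- the restricted conjugation `φ = conj_γ|` on `H`
  let φ : AddMonoid.End H :=
    AddMonoidHom.mk' (fun c ↦ ⟨W.conjH1 p κ.kerSubgroup γ c,
        conjH1_mem_unramifiedOutside κ.kerSubgroup (W.geomPrimaryTorsion p) p _ γ c.2⟩)
      (fun a b ↦ Subtype.ext (by
        change W.conjH1 p κ.kerSubgroup γ ((a : W.subgroupH1 p κ.kerSubgroup) + b) =
          W.conjH1 p κ.kerSubgroup γ a + W.conjH1 p κ.kerSubgroup γ b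
        exact map_add _ _ _))
  have hφ : ∀ s : H, ((φ s : H) : W.subgroupH1 p κ.kerSubgroup) = W.conjH1 p κ.kerSubgroup γ s := fun _ ↦ rfl
  have hT' : ∀ (y : Y) (s : H), dY ((PowerSeries.X : IwasawaAlgebra p) • y) s = dY y (φ s) - dY y s :=
    fun y s ↦ hT y s
  have htor : ∀ s : H, ∃ k : ℕ, p ^ k • s = 0 := fun s ↦ by
    obtain ⟨k, hk⟩ := W.exists_pow_smul_subgroupH1_ker_eq_zero κ (s : W.subgroupH1 p κ.kerSubgroup)
    exact ⟨k, Subtype.ext (by rw [AddSubmonoidClass.coe_nsmul]; exact hk)⟩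
  -- the finite set of bad `p`-adic parameters, and a unit `u` avoiding it with its inverse
  obtain ⟨u, hu, hunit, hc₁, hc₂⟩ :=
    exists_int_unit_avoiding p (IwasawaAlgebra.finite_setOf_not_finite_quotient_X_sub_C p hY)
  set c₂ : ℤ_[p] := Ring.inverse (u : ℤ_[p]) - 1 with hc₂def
  have hlt1 : ‖((u - 1 : ℤ) : ℤ_[p])‖ < 1 := (PadicInt.norm_int_lt_one_iff_dvd (u - 1)).mpr hu
  have hc₁mem : ((u : ℤ_[p]) - 1) ∈ IsLocalRing.maximalIdeal ℤ_[p] := by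
    rw [IsLocalRing.mem_maximalIdeal]
    refine PadicInt.mem_nonunits.mpr ?_
    have : ((u : ℤ_[p]) - 1) = ((u - 1 : ℤ) : ℤ_[p]) := by push_cast; ring
    rw [this]; exact hlt1
  have hc₂mem : c₂ ∈ IsLocalRing.maximalIdeal ℤ_[p] := by
    rw [IsLocalRing.mem_maximalIdeal]
    refine PadicInt.mem_nonunits.mpr ?_
    have : c₂ = Ring.inverse (u : ℤ_[p]) * ((1 - u : ℤ) : ℤ_[p]) := by
      rw [hc₂def, Int.cast_sub, Int.cast_one, mul_sub, mul_one, Ring.inverse_mul_cancel _ hunit]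
    rw [this, norm_mul]
    have h2 : ‖((1 - u : ℤ) : ℤ_[p])‖ < 1 := (PadicInt.norm_int_lt_one_iff_dvd (1 - u)).mpr (by
      rw [← neg_sub]; exact (dvd_neg).mpr hu)
    calc ‖Ring.inverse (u : ℤ_[p])‖ * ‖((1 - u : ℤ) : ℤ_[p])‖ ≤ 1 * ‖((1 - u : ℤ) : ℤ_[p])‖ :=
        mul_le_mul_of_nonneg_right (PadicInt.norm_le_one _) (norm_nonneg _)
      _ < 1 := by rw [one_mul]; exact h2
  have hfin₁ : Finite (Y ⧸ (Ideal.span {(PowerSeries.X - PowerSeries.C ((u : ℤ_[p]) - 1) : IwasawaAlgebra p)} •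
      (⊤ : Submodule (IwasawaAlgebra p) Y))) := by
    by_contra h; exact hc₁ ⟨hc₁mem, h⟩
  have hfin₂ : Finite (Y ⧸ (Ideal.span {(PowerSeries.X - PowerSeries.C c₂ : IwasawaAlgebra p)} •
      (⊤ : Submodule (IwasawaAlgebra p) Y))) := by
    by_contra h; exact hc₂ ⟨hc₂mem, h⟩
  -- `u (1 + c̄₂) ≡ 1 (mod p^k)` at every level
  have huc : ∀ k : ℕ, ((p : ℤ) ^ k) ∣ u * (1 + ((PadicInt.toZModPow k c₂).val : ℤ)) - 1 := by
    intro k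
    haveI : NeZero (p ^ k) := ⟨pow_ne_zero k hprime.ne_zero⟩
    have h0 : (PadicInt.toZModPow k (u : ℤ_[p])) * (1 + PadicInt.toZModPow k c₂) = 1 := by
      rw [← map_one (PadicInt.toZModPow k), ← map_add, ← map_mul, hc₂def, add_sub_cancel,
        Ring.mul_inverse_cancel _ hunit]
    have h1 : (((u * (1 + ((PadicInt.toZModPow k c₂).val : ℤ)) - 1 : ℤ)) : ZMod (p ^ k)) = 0 := by
      rw [Int.cast_sub, Int.cast_mul, Int.cast_add, Int.cast_one, Int.cast_natCast, ZMod.natCast_zmod_val,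
        ← map_intCast (PadicInt.toZModPow k) u, h0, sub_self]
    have h2 := (ZMod.intCast_zmod_eq_zero_iff_dvd _ (p ^ k)).mp h1
    exact_mod_cast h2
  -- the two FINITE eigenspaces
  have hAfin : {s : H | φ s = u • s}.Finite :=
    IwasawaDual.finite_setOf_apply_eq_zsmul_of_finite_quotient φ dY htor hT' hC hbij u hfin₁
  have hBfin : {s : H | u • φ s = s}.Finite :=
    finite_setOf_zsmul_apply_eq_of_finite_quotient φ dY htor hT' hC hbij c₂ u huc hfin₂
  -- their images in `H¹(K_∞, E[p^∞])` (plain classes), still finite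
  obtain ⟨A', hA'⟩ : ∃ A' : Set (W.subgroupH1 p κ.kerSubgroup),
      A' = (fun s : H ↦ (s : W.subgroupH1 p κ.kerSubgroup)) '' {s : H | φ s = u • s} := ⟨_, rfl⟩
  obtain ⟨B', hB'⟩ : ∃ B' : Set (W.subgroupH1 p κ.kerSubgroup),
      B' = (fun s : H ↦ (s : W.subgroupH1 p κ.kerSubgroup)) '' {s : H | u • φ s = s} := ⟨_, rfl⟩
  haveI : Finite A' := hA' ▸ (hAfin.image _).to_subtype
  haveI : Finite B' := hB' ▸ (hBfin.image _).to_subtype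
  obtain ⟨N, hN⟩ : ∃ N : ℕ, N = Nat.card A' * Nat.card B' := ⟨_, rfl⟩
  -- the bad places as a finite set
  have hbadfin : {w : HeightOneSpectrum (𝓞 K) | ¬ W.HasGoodReductionAt w}.Finite := by
    have h := W.eventually_hasGoodReductionAt
    rwa [Filter.eventually_cofinite] at h
  set S₁ : Finset (HeightOneSpectrum (𝓞 K)) := hbadfin.toFinset with hS₁
  have hgood₁ : ∀ w : HeightOneSpectrum (𝓞 K), w ∉ S₁ → ((p : ℕ) : 𝓞 K) ∉ w.asIdeal → W.HasGoodReductionAt w := by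
    intro w hw _
    by_contra h
    exact hw (hbadfin.mem_toFinset.mpr h)
  -- at level `k = N + 1`
  obtain ⟨k, hk⟩ : ∃ k : ℕ, k = N + 1 := ⟨_, rfl⟩
  have hkpos : 0 < k := by omega
  set u' : ℤ := 1 + ((PadicInt.toZModPow k c₂).val : ℤ) with hu'def
  have huu' : ((p : ℤ) ^ k) ∣ u * u' - 1 := huc k
  have hu' : (p : ℤ) ∣ u' - 1 := by
    have h1 : (p : ℤ) ∣ u * u' - 1 := (dvd_pow_self (p : ℤ) hkpos.ne').trans huu'
    have h2 : u' - 1 = (u * u' - 1) - (u - 1) * u' := by ring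
    rw [h2]
    exact dvd_sub h1 (dvd_mul_of_dvd_left hu _)
  -- T1: the relaxed twisted count at level `k`
  have hcount := RelaxedTwistCount.prime_pow_le_natCard_selmerGroup_twisted_mul W p κ S₁ hPT hgood₁ hpv hkpos
    hu hu' huu'
  -- the relaxed twisted classes restrict INTO `H`, injectively (T2), landing in the two eigenspaces
  have hmemH : ∀ (w : ℤ) (hw : (p : ℤ) ∣ w - 1)
      (x : galoisCohomology (W.twistedTorsionGaloisModule p κ k w hw) 1),
      x ∈ (W.twistedRelaxedSelmerStructure p S₁ κ k w hw).selmerGroup →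
        W.twistedTorsionToH1 p κ k w hw x ∈ H := by
    intro w hw x hx
    refine MultTransportTwistedDescent.twistedTorsionToH1_mem_unramifiedOutside W p κ k w hw S₀ x
      (fun v' hv' hpv' ↦ ?_)
    have hv'S₁ : v' ∉ S₁ := fun hmem ↦ (hbadfin.mem_toFinset.mp hmem) (hgood v' hv' hpv')
    exact W.res_mem_unramifiedSubgroup_of_mem_selmerGroup_relaxed p S₁ κ k w hw hx hv'S₁ hpv'
  have hinj : ∀ (w : ℤ) (hw : (p : ℤ) ∣ w - 1), Function.Injective (W.twistedTorsionToH1 p κ k w hw) :=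
    fun w hw ↦ TwistRestrict.twistedTorsionToH1_injective W p κ k w hw hK
  -- `H¹_rel(K, E[p^k](χ_u)) ↪ B'` and `H¹_rel(K, E[p^k](χ_{u'})) ↪ A'`
  have hmemB : ∀ x : (W.twistedRelaxedSelmerStructure p S₁ κ k u hu).selmerGroup,
      W.twistedTorsionToH1 p κ k u hu x.1 ∈ B' := fun x ↦
    hB' ▸ ⟨⟨W.twistedTorsionToH1 p κ k u hu x.1, hmemH u hu x.1 x.2⟩, Subtype.ext (by
      rw [AddSubgroupClass.coe_zsmul, hφ]
      exact W.zsmul_conjH1_twistedTorsionToH1 p κ k u hu hγ x.1), rfl⟩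
  have hmemA : ∀ x : (W.twistedRelaxedSelmerStructure p S₁ κ k u' hu').selmerGroup,
      W.twistedTorsionToH1 p κ k u' hu' x.1 ∈ A' := fun x ↦
    hA' ▸ ⟨⟨W.twistedTorsionToH1 p κ k u' hu' x.1, hmemH u' hu' x.1 x.2⟩, Subtype.ext (by
      rw [hφ, AddSubgroupClass.coe_zsmul]
      exact W.conjH1_twistedTorsionToH1_eq_zsmul p κ k hu' huu' hγ x.1), rfl⟩
  have hcardB : Nat.card (W.twistedRelaxedSelmerStructure p S₁ κ k u hu).selmerGroup ≤ Nat.card B' :=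
    Nat.card_le_card_of_injective (fun x ↦ (⟨_, hmemB x⟩ : B')) fun x y h ↦
      Subtype.ext (hinj u hu (congrArg Subtype.val h))
  have hcardA : Nat.card (W.twistedRelaxedSelmerStructure p S₁ κ k u' hu').selmerGroup ≤ Nat.card A' :=
    Nat.card_le_card_of_injective (fun x ↦ (⟨_, hmemA x⟩ : A')) fun x y h ↦
      Subtype.ext (hinj u' hu' (congrArg Subtype.val h))
  have hle : p ^ (2 * k) ≤ N := by
    calc p ^ (2 * k) ≤ Nat.card (W.twistedRelaxedSelmerStructure p S₁ κ k u hu).selmerGroup *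
          Nat.card (W.twistedRelaxedSelmerStructure p S₁ κ k u' hu').selmerGroup := hcount
      _ ≤ Nat.card B' * Nat.card A' := Nat.mul_le_mul hcardB hcardA
      _ = N := by rw [hN, mul_comm]
  -- but `N < p^N ≤ p^{2(N+1)}`
  have hlt : N < p ^ (2 * k) :=
    (Nat.lt_pow_self hprime.one_lt).trans_le (Nat.pow_le_pow_right hprime.pos (by omega))
  exact absurd hle (not_le.mpr hlt)

end Assembly

end Summit.BirchSwinnertonDyer.BirchSwinnertonDyer.Theorems.SignedEC.TwistNotTorsion

end
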